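import Mathlib
import HarnessLib
import Literature.Analysis.FluidPDE.LeraySelfSimilarCalculus
import Literature.Analysis.FluidPDE.FlatSwirlGauge
import Literature.Analysis.PDE.LoewnerNirenbergFacts
import Literature.Analysis.FluidPDE.VorticityCalculus
import Summits.NavierStokesRegularity.NavierStokesRegularity.Theorems.TypeIQuarterGateScarEnvelopeTypeIForcedTsaiDefs
import Summits.NavierStokesRegularity.NavierStokesRegularity.Theorems.TypeIQuarterGateScarEnvelopeTypeIForcedTsaiHomogeneousTail

/-!
# ARM B — REGISTERED TAIL DICHOTOMY, part 1: SCALING of the steady residual of an exactly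
  `(−1)`-homogeneous far field (ns-wall-extremal; (C2) of LINEAR-FLOOR §3 / DATUM B-2k, kernel)

Cell ns-wall-extremal, seat ns-wall-eng-1 g7.  A field `V : ℝ³ → ℝ³` is *exactly `(−1)`-homogeneous*
when `V (c • y) = c⁻¹ • V y` for all `c > 0` and all `y` — the Type-I velocity envelope taken
literally (Stokeslet, Landau, the swirl tail `(y × e)/|y|²`, …).  Equivalently it is a FIXED POINT of
the Navier–Stokes scaling `V ↦ c • V(c ·)` (`nsRescale_eq_self`).  Because every operator in the
steady Navier–Stokes residual `G_V := −ΔV + (V·∇)V` and in the registered currency of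
`…ForcedTsaiDefs` has a definite scaling weight, and because the tree's dilation calculus
(`LeraySelfSimilarCalculus`, `FlatSwirlGauge`, `LoewnerNirenbergFacts`) holds WITHOUT differentiability
hypotheses (Mathlib's total `fderiv`), homogeneity propagates UNCONDITIONALLY:

* `steadyResidual_smul` — `G_V(c x) = c⁻³ • G_V(x)`, written as `c³ • G_V(c x) = G_V(x)`;
* `curl_steadyResidual_smul` — `curl G_V (c x) = c⁻⁴ • curl G_V (x)` (written `c⁴ • … = …`);
* `divergence_smul_of_homogeneous` — `div V (x) = c² · div V (c x)`;
* `lerayMomentumResidual_eq_steadyResidual` — at a point of differentiability the REGISTERED Leray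
  momentum residual of `V` IS `G_V` (the drift `½V + ½DV·y` vanishes, p688729);
* transfer to a field `U` that merely COINCIDES with `V` outside a ball (`U = V` on `{ρ < ‖y‖}`):
  `lerayMomentumResidual_congr` (locality), `lerayVorticityResidual_eq_curl_steadyResidual`
  (`g_U = curl G_V` outside the ball, for `U ∈ C¹`), and the DYADIC LAW
  `lerayVorticityResidual_two_pow_smul`: `g_U(2^k y) = (2^k)⁻⁴ • g_U(y)` for `ρ < ‖y‖`;
* `contDiffAt_of_homogeneousTail` — if `U ∈ Cⁿ` then `V` is `Cⁿ` at every `x ≠ 0`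
  (`V = c • U(c ·)` near `x` for `c` large).

Part 2 (`…HomogeneousTailDichotomy`) turns the dyadic law + integrability of the registered weighted
residual into `g_U ≡ 0` outside the ball and the steady Navier–Stokes system for `V` off the origin.

HONEST FRAME.  Identity-grade helper (`--supports stmt-NavierStokesRegularity-23843`); no number of
record changes; nothing here bears on Navier–Stokes regularity.  Crux `ScarEnvelopeTypeI`
(stmt-23843) / wall H3 OPEN; NS regularity NOT proved.
-/

noncomputable section

set_option linter.dupNamespace false

namespace Summit.NavierStokesRegularity.NavierStokesRegularity.Cruxes.ScarEnvelopeTypeI.ForcedTsai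

open MeasureTheory Set Metric Filter Topology
open scoped ContDiff Laplacian InnerProductSpace RealInnerProductSpace
open Literature.Analysis.FluidPDE
open Literature.Analysis.PDE.LoewnerNirenberg

namespace TailDichotomy

variable {V U : E3 → E3} {ρ : ℝ}

/-! ## Exactly `(−1)`-homogeneous fields are fixed points of the Navier–Stokes scaling -/

/-- An exactly `(−1)`-homogeneous field is a fixed point of the Navier–Stokes scaling
`V ↦ c • V(c ·)`, `c > 0`. -/
theorem nsRescale_eq_self (hV : ∀ c : ℝ, 0 < c → ∀ y : E3, V (c • y) = c⁻¹ • V y) {c : ℝ}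
    (hc : 0 < c) : (fun y : E3 => c • V (c • y)) = V := by
  funext y
  rw [hV c hc y, smul_smul, mul_inv_cancel₀ hc.ne', one_smul]

/-- An exactly `(−1)`-homogeneous field vanishes at the origin (junk-value bookkeeping). -/
theorem apply_zero_of_homogeneous (hV : ∀ c : ℝ, 0 < c → ∀ y : E3, V (c • y) = c⁻¹ • V y) :
    V 0 = 0 := by
  have h := hV 2 two_pos 0
  rw [smul_zero] at h
  have h2 : (2 : ℝ)⁻¹ • V 0 - V 0 = 0 := by rw [← h, sub_self]
  have h3 : ((2 : ℝ)⁻¹ - 1) • V 0 = 0 := by rw [sub_smul, one_smul, h2]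
  rcases smul_eq_zero.mp h3 with h4 | h4
  · norm_num at h4
  · exact h4

/-! ## Unconditional scaling of the steady residual, its curl, and the divergence -/

/-- **The steady Navier–Stokes residual `G_V = −ΔV + (V·∇)V` of an exactly `(−1)`-homogeneous field
is `(−3)`-homogeneous**: `c³ • G_V(c x) = G_V(x)` for `c > 0` — NO differentiability hypothesis
(both `Δ` and `(V·∇)V` scale with weight `3` under `V ↦ c • V(c ·)`, unconditionally). -/
theorem steadyResidual_smul (hV : ∀ c : ℝ, 0 < c → ∀ y : E3, V (c • y) = c⁻¹ • V y) {c : ℝ}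
    (hc : 0 < c) (x : E3) :
    c ^ 3 • (-((Δ V) (c • x)) + convect V V (c • x)) = -((Δ V) x) + convect V V x := by
  have h1 : (Δ (fun y : E3 => c • V (c • y))) x = (c * c ^ 2) • (Δ V) (c • x) :=
    laplacian_const_smul_comp_smul' V c c x
  have h2 : convect (fun y : E3 => c • V (c • y)) (fun y : E3 => c • V (c • y)) x
      = c ^ 3 • convect V V (c • x) := convect_smul_comp_smul V c x
  rw [nsRescale_eq_self hV hc] at h1 h2
  rw [h1, h2, smul_add, smul_neg]
  congr 2
  rw [show c * c ^ 2 = c ^ 3 by ring]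

/-- Pointwise form: `G_V(c x) = (c³)⁻¹ • G_V(x)`. -/
theorem steadyResidual_smul' (hV : ∀ c : ℝ, 0 < c → ∀ y : E3, V (c • y) = c⁻¹ • V y) {c : ℝ}
    (hc : 0 < c) (x : E3) :
    -((Δ V) (c • x)) + convect V V (c • x) = (c ^ 3)⁻¹ • (-((Δ V) x) + convect V V x) := by
  rw [← steadyResidual_smul hV hc x, smul_smul, inv_mul_cancel₀ (pow_ne_zero 3 hc.ne'), one_smul]

/-- The steady residual as a rescaling-fixed lambda: `c³ • G_V(c ·) = G_V`. -/
theorem steadyResidual_rescale_eq (hV : ∀ c : ℝ, 0 < c → ∀ y : E3, V (c • y) = c⁻¹ • V y)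
    {c : ℝ} (hc : 0 < c) :
    (fun y : E3 => c ^ 3 • (fun z : E3 => -((Δ V) z) + convect V V z) (c • y))
      = fun z : E3 => -((Δ V) z) + convect V V z := by
  funext y
  exact steadyResidual_smul hV hc y

/-- **The curl of the steady residual is `(−4)`-homogeneous**: `c⁴ • curl G_V (c x) = curl G_V (x)`,
`c > 0`, unconditionally. -/
theorem curl_steadyResidual_smul (hV : ∀ c : ℝ, 0 < c → ∀ y : E3, V (c • y) = c⁻¹ • V y)
    {c : ℝ} (hc : 0 < c) (x : E3) :
    c ^ 4 • curl (fun z : E3 => -((Δ V) z) + convect V V z) (c • x)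
      = curl (fun z : E3 => -((Δ V) z) + convect V V z) x := by
  have h := curl_smul_comp_smul (fun z : E3 => -((Δ V) z) + convect V V z) (c ^ 3) c x
  rw [steadyResidual_rescale_eq hV hc] at h
  rw [h, show c ^ 3 * c = c ^ 4 by ring]

/-- Pointwise form: `curl G_V (c x) = (c⁴)⁻¹ • curl G_V (x)`. -/
theorem curl_steadyResidual_smul' (hV : ∀ c : ℝ, 0 < c → ∀ y : E3, V (c • y) = c⁻¹ • V y)
    {c : ℝ} (hc : 0 < c) (x : E3) :
    curl (fun z : E3 => -((Δ V) z) + convect V V z) (c • x)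
      = (c ^ 4)⁻¹ • curl (fun z : E3 => -((Δ V) z) + convect V V z) x := by
  rw [← curl_steadyResidual_smul hV hc x, smul_smul, inv_mul_cancel₀ (pow_ne_zero 4 hc.ne'),
    one_smul]

/-- **The divergence of an exactly `(−1)`-homogeneous field is `(−2)`-homogeneous**:
`div V (x) = c² · div V (c x)`, unconditionally. -/
theorem divergence_smul_of_homogeneous (hV : ∀ c : ℝ, 0 < c → ∀ y : E3, V (c • y) = c⁻¹ • V y)
    {c : ℝ} (hc : 0 < c) (x : E3) :
    VectorCalculus.divergence V x = c ^ 2 * VectorCalculus.divergence V (c • x) := by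
  have h := divergence_smul_comp_smul V c x
  rw [nsRescale_eq_self hV hc] at h
  exact h

/-! ## The registered residual of `V` and of a field coinciding with `V` outside a ball -/

/-- **At a point of differentiability, the registered Leray momentum residual of an exactly
`(−1)`-homogeneous field IS its steady Navier–Stokes residual** `G_V` (the Leray drift
`½V + ½DV·y` vanishes by Euler's identity, p688729). -/
theorem lerayMomentumResidual_eq_steadyResidual
    (hV : ∀ c : ℝ, 0 < c → ∀ y : E3, V (c • y) = c⁻¹ • V y) {y : E3}
    (hd : DifferentiableAt ℝ V y) :
    lerayMomentumResidual V y = -((Δ V) y) + convect V V y :=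
  lerayMomentumResidual_of_homogeneous_neg_one (fun t ht => hV t ht y) hd

/-- **Locality of the registered momentum residual**: fields that agree near `y` have the same
`lerayMomentumResidual` at `y`. -/
theorem lerayMomentumResidual_congr {U W : E3 → E3} {y : E3} (h : U =ᶠ[𝓝 y] W) :
    lerayMomentumResidual U y = lerayMomentumResidual W y := by
  rw [lerayMomentumResidual, lerayMomentumResidual, convect, convect,
    (InnerProductSpace.laplacian_congr_nhds h).eq_of_nhds, h.fderiv_eq, h.eq_of_nhds]

/-- The exterior `{ρ < ‖y‖}` of a closed ball is open. -/
theorem isOpen_exterior (ρ : ℝ) : IsOpen {y : E3 | ρ < ‖y‖} :=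
  isOpen_lt continuous_const continuous_norm

/-- A field that equals `V` on `{ρ < ‖y‖}` agrees with `V` near every such point. -/
theorem eventuallyEq_of_tail (hU : ∀ y : E3, ρ < ‖y‖ → U y = V y) {x : E3} (hx : ρ < ‖x‖) :
    U =ᶠ[𝓝 x] V :=
  Filter.eventually_of_mem ((isOpen_exterior ρ).mem_nhds hx) fun y hy => hU y hy

/-- Outside the ball, the registered momentum residual of a `C¹` field `U` with the exactly
homogeneous tail `V` IS the steady residual `G_V`. -/
theorem lerayMomentumResidual_eq_steadyResidual_of_tail (hU1 : ContDiff ℝ 1 U)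
    (hV : ∀ c : ℝ, 0 < c → ∀ y : E3, V (c • y) = c⁻¹ • V y)
    (hU : ∀ y : E3, ρ < ‖y‖ → U y = V y) {x : E3} (hx : ρ < ‖x‖) :
    lerayMomentumResidual U x = -((Δ V) x) + convect V V x := by
  have hloc := eventuallyEq_of_tail hU hx
  have hdU : DifferentiableAt ℝ U x := (hU1.differentiable (by simp)) x
  have hdV : DifferentiableAt ℝ V x := hloc.differentiableAt_iff.mp hdU
  rw [lerayMomentumResidual_congr hloc, lerayMomentumResidual_eq_steadyResidual hV hdV]

/-- The same as an eventual equality of functions near every exterior point. -/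
theorem lerayMomentumResidual_eventuallyEq_steadyResidual (hU1 : ContDiff ℝ 1 U)
    (hV : ∀ c : ℝ, 0 < c → ∀ y : E3, V (c • y) = c⁻¹ • V y)
    (hU : ∀ y : E3, ρ < ‖y‖ → U y = V y) {x : E3} (hx : ρ < ‖x‖) :
    lerayMomentumResidual U =ᶠ[𝓝 x] fun z : E3 => -((Δ V) z) + convect V V z :=
  Filter.eventually_of_mem ((isOpen_exterior ρ).mem_nhds hx)
    fun _ hy => lerayMomentumResidual_eq_steadyResidual_of_tail hU1 hV hU hy

/-- **Outside the ball, the registered vorticity residual of `U` is `curl G_V`.** -/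
theorem lerayVorticityResidual_eq_curl_steadyResidual (hU1 : ContDiff ℝ 1 U)
    (hV : ∀ c : ℝ, 0 < c → ∀ y : E3, V (c • y) = c⁻¹ • V y)
    (hU : ∀ y : E3, ρ < ‖y‖ → U y = V y) {x : E3} (hx : ρ < ‖x‖) :
    lerayVorticityResidual U x = curl (fun z : E3 => -((Δ V) z) + convect V V z) x := by
  rw [lerayVorticityResidual, curl_eq_curlCLM,
    (lerayMomentumResidual_eventuallyEq_steadyResidual hU1 hV hU hx).fderiv_eq, ← curl_eq_curlCLM]

/-- **SCALING LAW for the registered residual of a field with an exactly homogeneous tail**: for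
`ρ ≥ 0`, `ρ < ‖y‖` and `c ≥ 1`, `g_U(c y) = (c⁴)⁻¹ • g_U(y)`. -/
theorem lerayVorticityResidual_smul_of_tail (hU1 : ContDiff ℝ 1 U)
    (hV : ∀ c : ℝ, 0 < c → ∀ y : E3, V (c • y) = c⁻¹ • V y) (hρ : 0 ≤ ρ)
    (hU : ∀ y : E3, ρ < ‖y‖ → U y = V y) {y : E3} (hy : ρ < ‖y‖) {c : ℝ} (hc : 1 ≤ c) :
    lerayVorticityResidual U (c • y) = (c ^ 4)⁻¹ • lerayVorticityResidual U y := by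
  have hc0 : 0 < c := lt_of_lt_of_le one_pos hc
  have hcy : ρ < ‖c • y‖ := by
    rw [norm_smul, Real.norm_of_nonneg hc0.le]
    have : ‖y‖ ≤ c * ‖y‖ := le_mul_of_one_le_left (le_trans hρ hy.le) hc
    exact lt_of_lt_of_le hy this
  rw [lerayVorticityResidual_eq_curl_steadyResidual hU1 hV hU hcy,
    lerayVorticityResidual_eq_curl_steadyResidual hU1 hV hU hy, curl_steadyResidual_smul' hV hc0]

/-- **DYADIC LAW**: `g_U(2^k • y) = ((2^k)⁴)⁻¹ • g_U(y)` for `ρ < ‖y‖` (`ρ ≥ 0`). -/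
theorem lerayVorticityResidual_two_pow_smul (hU1 : ContDiff ℝ 1 U)
    (hV : ∀ c : ℝ, 0 < c → ∀ y : E3, V (c • y) = c⁻¹ • V y) (hρ : 0 ≤ ρ)
    (hU : ∀ y : E3, ρ < ‖y‖ → U y = V y) {y : E3} (hy : ρ < ‖y‖) (k : ℕ) :
    lerayVorticityResidual U ((2 : ℝ) ^ k • y)
      = (((2 : ℝ) ^ k) ^ 4)⁻¹ • lerayVorticityResidual U y :=
  lerayVorticityResidual_smul_of_tail hU1 hV hρ hU hy (one_le_pow₀ (by norm_num))

/-! ## Smoothness of the homogeneous tail off the origin -/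

/-- Near every `x ≠ 0` an exactly homogeneous `V` coinciding with `U` outside a ball is a
Navier–Stokes rescaling of `U`: `V = c • U(c ·)` near `x` for every `c > 0` with `ρ < c‖x‖`. -/
theorem eventuallyEq_rescale_of_homogeneousTail
    (hV : ∀ c : ℝ, 0 < c → ∀ y : E3, V (c • y) = c⁻¹ • V y)
    (hU : ∀ y : E3, ρ < ‖y‖ → U y = V y) {x : E3} {c : ℝ} (hc : 0 < c) (hcx : ρ < c * ‖x‖) :
    V =ᶠ[𝓝 x] fun y : E3 => c • U (c • y) := by
  have hopen : IsOpen {y : E3 | ρ < c * ‖y‖} :=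
    isOpen_lt continuous_const (continuous_const.mul continuous_norm)
  refine Filter.eventually_of_mem (hopen.mem_nhds hcx) fun y hy => ?_
  have hcy : ρ < ‖c • y‖ := by rwa [norm_smul, Real.norm_of_nonneg hc.le]
  have h := congrFun (nsRescale_eq_self hV hc) y
  show V y = c • U (c • y)
  rw [hU (c • y) hcy]
  exact h.symm

/-- **If `U ∈ Cⁿ` then its exactly homogeneous tail `V` is `Cⁿ` at every `x ≠ 0`** (for `ρ ≥ 0`). -/
theorem contDiffAt_of_homogeneousTail {n : WithTop ℕ∞} (hUn : ContDiff ℝ n U)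
    (hV : ∀ c : ℝ, 0 < c → ∀ y : E3, V (c • y) = c⁻¹ • V y) (hρ : 0 ≤ ρ)
    (hU : ∀ y : E3, ρ < ‖y‖ → U y = V y) {x : E3} (hx : x ≠ 0) : ContDiffAt ℝ n V x := by
  have hxn : 0 < ‖x‖ := norm_pos_iff.mpr hx
  set c : ℝ := (ρ + 1) / ‖x‖ with hc_def
  have hc : 0 < c := div_pos (by linarith) hxn
  have hcx : ρ < c * ‖x‖ := by
    rw [hc_def, div_mul_cancel₀ _ hxn.ne']
    linarith
  have hsm : ContDiffAt ℝ n (fun y : E3 => c • U (c • y)) x :=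
    ((hUn.comp (contDiff_const_smul c)).const_smul c).contDiffAt
  exact hsm.congr_of_eventuallyEq (eventuallyEq_rescale_of_homogeneousTail hV hU hc hcx)

/-- The exactly homogeneous tail of a `Cⁿ` field is `Cⁿ` on `ℝ³ ∖ {0}`. -/
theorem contDiffOn_of_homogeneousTail {n : WithTop ℕ∞} (hUn : ContDiff ℝ n U)
    (hV : ∀ c : ℝ, 0 < c → ∀ y : E3, V (c • y) = c⁻¹ • V y) (hρ : 0 ≤ ρ)
    (hU : ∀ y : E3, ρ < ‖y‖ → U y = V y) : ContDiffOn ℝ n V {0}ᶜ :=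
  fun _ hx => (contDiffAt_of_homogeneousTail hUn hV hρ hU hx).contDiffWithinAt

end TailDichotomy

end Summit.NavierStokesRegularity.NavierStokesRegularity.Cruxes.ScarEnvelopeTypeI.ForcedTsai

end
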